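import Literature.Geometry.Riemannian.SimpleAHBoundarySphere
import Literature.Geometry.Riemannian.ConformalHessian
import Literature.Geometry.Riemannian.HessianBound
import Literature.Geometry.Lorentzian.DalembertianNaturality
import Literature.Geometry.Lorentzian.IsometryProofs
import Literature.Geometry.Riemannian.CartanHadamardLift
import Literature.Topology.FourManifolds.CollarTheorem
import HarnessLib

/-!
# Asymptotically hyperbolic ends: the level sets of the boundary-defining function are
strictly convex near infinity

Support file for the discharge of
`Literature.Geometry.Riemannian.ggsu_boundary_sphere_of_nonTrapping_of_nonpos`
(`SimpleAHBoundarySphere.lean`), hypothesis (i) of that fact: `N` (model `𝓡 (n+1)`) with a smooth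
Riemannian metric `g`, a compact manifold with boundary `X` (model `𝓡∂ (n+1)`) with a smooth
metric `gb`, a smooth embedding `j : N → X` onto the interior, a boundary-defining function `ρ`
regular on `∂X`, and `j^* gb = (ρ ∘ j)² g`. We prove that for some `c₀ > 0`, at every point
`x ∈ N` with `ρ (j x) < c₀` the differential of `ρ ∘ j` is non-zero and the `g`-Hessian of `ρ ∘ j`
is negative definite on its kernel (the superlevel sets `{ρ ∘ j ≥ c}`, `c < c₀`, are strictly
convex): conformal transformation of the Hessian (`Conformal` lemmas), naturality of the Hessian
under `j` (`hessian_comap_apply`), boundedness of `Hess^{gb} ρ` on the compact `X`. Everything is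
proved; no definitions, no named facts.

## References

* C. R. Graham, C. Guillarmou, P. Stefanov, G. Uhlmann, *X-ray transform and boundary rigidity
  for asymptotically hyperbolic manifolds*, Ann. Inst. Fourier 69 (2019), §2.1 (asymptotically
  hyperbolic metrics, `|dρ|_{ρ²g} = 1` on the boundary). [GrahamEtAl2020]
* G. P. Paternain, M. Salo, G. Uhlmann, *Geometric Inverse Problems*, CUP 2023, Lemma 3.1.12
  (strict convexity through the Hessian of a defining function). [PaternainSaloUhlmann2023]
-/

noncomputable section

open Bundle Set Function Filter NormedSpace FiberBundle
open scoped Manifold ContDiff Topology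

namespace Literature.Geometry.Riemannian.GGSU

open Literature.Geometry.Lorentzian
open Literature.Geometry.Lorentzian.PseudoRiemannianMetric

section Embedding

variable {E : Type*} [NormedAddCommGroup E] [NormedSpace ℝ E] {H : Type*} [TopologicalSpace H]
  {I : ModelWithCorners ℝ E H} {M : Type*} [TopologicalSpace M] [ChartedSpace H M]
  {E' : Type*} [NormedAddCommGroup E'] [NormedSpace ℝ E'] {H' : Type*} [TopologicalSpace H']
  {I' : ModelWithCorners ℝ E' H'} {N : Type*} [TopologicalSpace N] [ChartedSpace H' N]

/-- A smooth embedding with open range has injective differentials (differentiate the smooth left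
inverse on the open range). [folklore] -/
theorem injective_mfderiv_of_isSmoothEmbedding [IsManifold I' ∞ N] [IsManifold I ∞ M]
    {j : N → M} (hj : Manifold.IsSmoothEmbedding I' I ∞ j) (hopen : IsOpen (range j)) (x : N) :
    Injective (mfderiv I' I j x) := by
  haveI : Nonempty N := ⟨x⟩
  set jInv : M → N := Function.invFun j with hjInv
  have hleft : LeftInverse jInv j := Function.leftInverse_invFun hj.isEmbedding.injective
  have hsmooth : ContMDiffOn I I' ∞ jInv (range j) :=
    Literature.Topology.FourManifolds.contMDiffOn_leftInverse_of_isImmersion hj.isImmersion hj.isEmbedding hleft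
  have h1 : MDifferentiableAt I I' jInv (j x) :=
    ((hsmooth (j x) (mem_range_self x)).contMDiffAt (hopen.mem_nhds (mem_range_self x)))
      |>.mdifferentiableAt (by simp)
  have h2 : MDifferentiableAt I' I j x := (hj.contMDiff x).mdifferentiableAt (by simp)
  have hcomp := mfderiv_comp x h1 h2
  have hid : mfderiv I' I' (jInv ∘ j) x = ContinuousLinearMap.id ℝ (TangentSpace I' x) := by
    have : jInv ∘ j = id := funext hleft
    rw [this, mfderiv_id]
  have hli : LeftInverse (mfderiv I I' jInv (j x)) (mfderiv I' I j x) := fun v ↦ by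
    have := ContinuousLinearMap.ext_iff.1 hid v
    rw [hcomp] at this
    exact this
  exact hli.injective

end Embedding

/-- Real arithmetic of the convexity estimate. [folklore] -/
theorem convexity_arith {A B r q s Hg Hn : ℝ} (hA0 : 0 ≤ A) (hB : 0 < B) (hr : 0 < r)
    (hq : 0 < q) (hx : r < 1 / ((A + 1) * B)) (h1 : Hn = Hg + q / r * s)
    (h2 : Hn ≤ A * (r ^ 2 * q)) (h3 : r ^ 2 / B ≤ s) : Hg < 0 := by
  have hqr : 0 ≤ q / r := div_nonneg hq.le hr.le
  have hmono : q / r * (r ^ 2 / B) ≤ q / r * s := mul_le_mul_of_nonneg_left h3 hqr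
  have hkey : Hg ≤ A * (r ^ 2 * q) - q / r * (r ^ 2 / B) := by linarith
  have e : A * (r ^ 2 * q) - q / r * (r ^ 2 / B) = r * q * (A * r - 1 / B) := by
    field_simp
  have hAB : 0 < (A + 1) * B := by positivity
  have hABr : (A + 1) * B * r < 1 := by
    have := (lt_div_iff₀ hAB).1 hx
    linarith
  have hneg : A * r - 1 / B < 0 := by
    rw [sub_neg, lt_div_iff₀ hB]
    nlinarith
  have hfinal : r * q * (A * r - 1 / B) < 0 := mul_neg_of_pos_of_neg (mul_pos hr hq) hneg
  linarith

/-! ### The asymptotically hyperbolic end -/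

section AH

variable {n : ℕ} {N : Type*} [TopologicalSpace N] [ChartedSpace (EuclideanSpace ℝ (Fin (n + 1))) N]
  [IsManifold (𝓡 (n + 1)) ∞ N]
  {X : Type*} [TopologicalSpace X] [ChartedSpace (EuclideanHalfSpace (n + 1)) X]
  [IsManifold (𝓡∂ (n + 1)) ∞ X]
  (g : ContMDiffRiemannianMetric (𝓡 (n + 1)) ∞ (EuclideanSpace ℝ (Fin (n + 1)))
    (TangentSpace (𝓡 (n + 1)) : N → Type _))
  (gb : ContMDiffRiemannianMetric (𝓡∂ (n + 1)) ∞ (EuclideanSpace ℝ (Fin (n + 1)))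
    (TangentSpace (𝓡∂ (n + 1)) : X → Type _))
  (j : N → X) (ρ : X → ℝ)

variable {g gb j ρ}

/-- Under `j^* gb = (ρ ∘ j)² g`, the pullback metric `j^* gb` is the conformal multiple
`(ρ ∘ j)² g` of `g` (as bilinear forms at every point). [folklore] -/
theorem val_comap_eq_conformal (hj : ContMDiff (𝓡 (n + 1)) (𝓡∂ (n + 1)) (∞ + 1) j)
    (hj' : ∀ x, Injective (mfderiv (𝓡 (n + 1)) (𝓡∂ (n + 1)) j x))
    (hconf : ∀ (x : N) (v w : TangentSpace (𝓡 (n + 1)) x),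
      gb.inner (j x) (mfderiv (𝓡 (n + 1)) (𝓡∂ (n + 1)) j x v)
        (mfderiv (𝓡 (n + 1)) (𝓡∂ (n + 1)) j x w) = ρ (j x) ^ 2 * g.inner x v w) (x : N) :
    ((ofRiemannian gb).comap contMDiff_pullbackBilin_holds j hj hj' rfl).val x =
      (ρ (j x)) ^ 2 • (ofRiemannian g).val x := by
  ext v w
  change gb.inner (j x) (mfderiv (𝓡 (n + 1)) (𝓡∂ (n + 1)) j x v)
      (mfderiv (𝓡 (n + 1)) (𝓡∂ (n + 1)) j x w) = ρ (j x) ^ 2 * g.inner x v w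
  exact hconf x v w

set_option maxHeartbeats 400000 in
/-- **Convexity of the level sets of `ρ ∘ j` near infinity.** In the setting of hypothesis (i) of
`ggsu_boundary_sphere_of_nonTrapping_of_nonpos` (`X` compact Hausdorff, `ρ ≥ 0` smooth,
`ρ = 0` exactly on `∂X` with `dρ ≠ 0` there, `range j = Int X`, `j` a smooth embedding,
`j^* gb = (ρ ∘ j)² g`), there is `c₀ > 0` such that at every `x ∈ N` with `ρ (j x) < c₀`:
`d(ρ ∘ j)_x ≠ 0`, and `Hess^g (ρ ∘ j)_x (u, u) < 0` for every non-zero `u ∈ ker d(ρ ∘ j)_x`.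
Proof: `Hess^g = Hess^{j^*gb} + (2/ρ) dρ ⊗ dρ - (1/ρ) |dρ|²_{g} g` (conformal change),
`Hess^{j^*gb}(ρ∘j) = j^* Hess^{gb} ρ ≤ A · gb` (naturality and compactness of `X`), and
`|d(ρ∘j)|²_g ≥ (ρ∘j)² / sup gb(ξ, ξ)` for a field `ξ` with `ξ(ρ) = 1` near `∂X`.
[cite: GrahamEtAl2020, §2.1 (asymptotically hyperbolic metrics), §5.1] -/
theorem exists_hessian_neg_near_infinity [T2Space X] [CompactSpace X]
    [(ofRiemannian g).HasLeviCivita]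
    (hj : Manifold.IsSmoothEmbedding (𝓡 (n + 1)) (𝓡∂ (n + 1)) ∞ j)
    (hrange : range j = (𝓡∂ (n + 1)).interior X)
    (hρ : ContMDiff (𝓡∂ (n + 1)) 𝓘(ℝ, ℝ) ∞ ρ) (hρ0 : ∀ z, 0 ≤ ρ z)
    (hρb : ∀ z, ρ z = 0 ↔ z ∈ (𝓡∂ (n + 1)).boundary X)
    (hreg : ∀ z, ρ z = 0 → mfderiv (𝓡∂ (n + 1)) 𝓘(ℝ, ℝ) ρ z ≠ 0)
    (hconf : ∀ (x : N) (v w : TangentSpace (𝓡 (n + 1)) x),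
      gb.inner (j x) (mfderiv (𝓡 (n + 1)) (𝓡∂ (n + 1)) j x v)
        (mfderiv (𝓡 (n + 1)) (𝓡∂ (n + 1)) j x w) = ρ (j x) ^ 2 * g.inner x v w) :
    ∃ c₀ > 0, ∀ x : N, ρ (j x) < c₀ →
      mvfderiv (𝓡 (n + 1)) (ρ ∘ j) x ≠ 0 ∧
      ∀ u : TangentSpace (𝓡 (n + 1)) x, u ≠ 0 → mvfderiv (𝓡 (n + 1)) (ρ ∘ j) x u = 0 →
        (ofRiemannian g).hessian (ρ ∘ j) x u u < 0 := by
  -- notation and standing facts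
  set G := ofRiemannian g with hG_def
  set Gb := ofRiemannian gb with hGb_def
  haveI : Gb.HasLeviCivita := Gb.hasLeviCivita
  have hGpos : G.IsRiemannian := isRiemannian_ofRiemannian g
  have hGbpos : Gb.IsRiemannian := isRiemannian_ofRiemannian gb
  have hopen : IsOpen (range j) := by
    rw [hrange]; exact ModelWithCorners.isOpen_interior (I := 𝓡∂ (n + 1)) (M := X) (n := ∞) (by simp)
  have hjs : ContMDiff (𝓡 (n + 1)) (𝓡∂ (n + 1)) (∞ + 1) j := hj.contMDiff
  have hj' : ∀ x, Injective (mfderiv (𝓡 (n + 1)) (𝓡∂ (n + 1)) j x) :=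
    injective_mfderiv_of_isSmoothEmbedding hj hopen
  set GN := Gb.comap contMDiff_pullbackBilin_holds j hjs hj' rfl with hGN_def
  haveI : GN.HasLeviCivita := GN.hasLeviCivita
  have hval : ∀ x, GN.val x = (ρ (j x)) ^ 2 • G.val x := val_comap_eq_conformal hjs hj' hconf
  -- `ρ ∘ j > 0` on `N`
  have hρpos : ∀ x : N, 0 < ρ (j x) := fun x ↦ by
    refine lt_of_le_of_ne (hρ0 _) fun h ↦ ?_
    have hb := (hρb (j x)).1 h.symm
    have hi : j x ∈ (𝓡∂ (n + 1)).interior X := hrange ▸ mem_range_self x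
    exact (ModelWithCorners.disjoint_interior_boundary (I := 𝓡∂ (n + 1)) (M := X)).le_bot ⟨hi, hb⟩
  -- a field `ξ` with `ξ(ρ) = 1` on `{ρ ≤ δ}`
  obtain ⟨δ', hδ', hδ'reg⟩ := Literature.Topology.FourManifolds.exists_pos_forall_mfderiv_ne_zero hρ hρ0 hreg
  set δ := δ' / 2 with hδ
  have hδpos : 0 < δ := by positivity
  have hreg2 : ∀ z ∈ {z : X | ρ z ≤ δ}, mfderiv (𝓡∂ (n + 1)) 𝓘(ℝ, ℝ) ρ z ≠ 0 := fun z hz ↦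
    hδ'reg z (by simp only [mem_setOf_eq] at hz; linarith)
  obtain ⟨ξ, hξ⟩ := Literature.Topology.FourManifolds.exists_contMDiffSection_mlineDeriv_eq_one_on hρ
    (isClosed_le hρ.continuous continuous_const) hreg2
  -- `gb(ξ, ξ) ≤ A''` on the compact `X`
  have hξcont : Continuous fun z ↦ Gb.val z (ξ z) (ξ z) := by
    refine continuous_iff_continuousAt.2 fun z ↦ ?_
    exact (Gb.contMDiffAt_val_apply (m := ∞) le_rfl (ξ.contMDiff z) (ξ.contMDiff z)).continuousAt
  obtain ⟨A'', hA''⟩ := (isCompact_univ : IsCompact (univ : Set X)).bddAbove_image hξcont.continuousOn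
  set B := max A'' 1 with hB
  have hBpos : 0 < B := lt_of_lt_of_le one_pos (le_max_right _ _)
  have hξB : ∀ z, Gb.val z (ξ z) (ξ z) ≤ B := fun z ↦
    (hA'' ⟨z, mem_univ _, rfl⟩).trans (le_max_left _ _)
  -- `Hess^{gb} ρ ≤ A gb` on the compact `X`
  obtain ⟨A, hA0, hA⟩ := exists_hessian_le_mul_val Gb hGbpos hρ
  -- the threshold
  refine ⟨min δ (1 / ((A + 1) * B)), lt_min hδpos (by positivity), fun x hx ↦ ?_⟩
  have hxδ : ρ (j x) ≤ δ := (lt_of_lt_of_le hx (min_le_left _ _)).le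
  have hxAB : ρ (j x) < 1 / ((A + 1) * B) := lt_of_lt_of_le hx (min_le_right _ _)
  set r := ρ (j x) with hr_def
  have hr : 0 < r := hρpos x
  -- the vector `v = dj⁻¹ ξ` with `d(ρ ∘ j)(v) = 1`
  have hbij := mfderiv_bijective_of_injective (hj' x) (rfl : Module.finrank ℝ
    (EuclideanSpace ℝ (Fin (n + 1))) = Module.finrank ℝ (EuclideanSpace ℝ (Fin (n + 1))))
  obtain ⟨v, hv⟩ := hbij.2 (ξ (j x))
  have hjd : MDifferentiableAt (𝓡 (n + 1)) (𝓡∂ (n + 1)) j x :=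
    ((hjs.of_le le_self_add) x).mdifferentiableAt (by simp)
  have hρd : MDifferentiableAt (𝓡∂ (n + 1)) 𝓘(ℝ, ℝ) ρ (j x) := (hρ (j x)).mdifferentiableAt (by simp)
  have hchain : ∀ w : TangentSpace (𝓡 (n + 1)) x, mvfderiv (𝓡 (n + 1)) (ρ ∘ j) x w =
      mvfderiv (𝓡∂ (n + 1)) ρ (j x) (mfderiv (𝓡 (n + 1)) (𝓡∂ (n + 1)) j x w) := fun w ↦ by
    simp only [mvfderiv, ContinuousLinearMap.coe_comp, Function.comp_apply]
    rw [mfderiv_comp x hρd hjd]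
    rfl
  have hdv : mvfderiv (𝓡 (n + 1)) (ρ ∘ j) x v = 1 := by
    rw [hchain, hv]
    exact hξ (j x) hxδ
  refine ⟨fun h0 ↦ by simp [h0] at hdv, fun u hu hdu ↦ ?_⟩
  -- the dual vector `♯ d(ρ ∘ j)` and the lower bound `|d(ρ∘j)|²_g ≥ r² / B`
  set α := mvfderiv (𝓡 (n + 1)) (ρ ∘ j) x with hα
  set wα : TangentSpace (𝓡 (n + 1)) x := G.sharp x α.toLinearMap with hwα
  have hGnn : ∀ (y : N) (w : TangentSpace (𝓡 (n + 1)) y), 0 ≤ G.val y w w := fun y w ↦ by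
    by_cases hw : w = 0
    · subst hw; simp
    · exact (hGpos y w hw).le
  have hCS := val_sq_le_mul G hGnn x wα v
  have h1 : G.val x wα v = 1 := by rw [hwα, val_sharp_apply]; exact hdv
  have hGNval : ∀ (y : N) (a b : TangentSpace (𝓡 (n + 1)) y), GN.val y a b =
      Gb.val (j y) (mfderiv (𝓡 (n + 1)) (𝓡∂ (n + 1)) j y a)
        (mfderiv (𝓡 (n + 1)) (𝓡∂ (n + 1)) j y b) := fun _ _ _ ↦ rfl
  have hvalap : ∀ (y : N) (a b : TangentSpace (𝓡 (n + 1)) y),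
      GN.val y a b = ρ (j y) ^ 2 * G.val y a b := fun y a b ↦ by
    rw [hval y]; rfl
  have hGv : G.val x v v = r⁻¹ ^ 2 * Gb.val (j x) (ξ (j x)) (ξ (j x)) := by
    have h := hvalap x v v
    rw [hGNval, hv, ← hr_def] at h
    rw [h]
    field_simp
  have hnormsq : r ^ 2 / B ≤ G.val x wα wα := by
    rw [h1, one_pow, hGv] at hCS
    have hξx := hξB (j x)
    have hwnn := hGnn x wα
    rw [div_le_iff₀ hBpos]
    calc r ^ 2 = r ^ 2 * 1 := by ring
      _ ≤ r ^ 2 * (G.val x wα wα * (r⁻¹ ^ 2 * Gb.val (j x) (ξ (j x)) (ξ (j x)))) :=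
          mul_le_mul_of_nonneg_left hCS (sq_nonneg r)
      _ = G.val x wα wα * Gb.val (j x) (ξ (j x)) (ξ (j x)) := by field_simp
      _ ≤ G.val x wα wα * B := mul_le_mul_of_nonneg_left hξx hwnn
  -- the conformal transformation of the Hessian
  have hρjd : MDifferentiableAt (𝓡 (n + 1)) 𝓘(ℝ, ℝ) (ρ ∘ j) x := hρd.comp x hjd
  have hρ2 : ContMDiffAt (𝓡∂ (n + 1)) 𝓘(ℝ, ℝ) 2 ρ (j x) :=
    (hρ (j x)).of_le (WithTop.coe_le_coe.mpr le_top)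
  have hρj2 : ContMDiffAt (𝓡 (n + 1)) 𝓘(ℝ, ℝ) 2 (ρ ∘ j) x :=
    hρ2.comp x ((hjs.of_le (by exact (WithTop.coe_le_coe.mpr le_top).trans le_self_add)) x)
  have hconfH := hessian_conformal_apply_self (g := G) (ĝ := GN) (r := ρ ∘ j) hval hρjd hr.ne'
    hρj2 u
  simp only [Function.comp_apply, ← hr_def, ← hα, hdu, mul_zero, zero_div, sub_zero] at hconfH
  -- naturality: `Hess^{j^*gb}(ρ ∘ j)(u,u) = Hess^{gb} ρ (dj u, dj u) ≤ A gb(dj u, dj u) = A r² g(u,u)`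
  have hnat : GN.hessian (ρ ∘ j) x u u = Gb.hessian ρ (j x)
      (mfderiv (𝓡 (n + 1)) (𝓡∂ (n + 1)) j x u) (mfderiv (𝓡 (n + 1)) (𝓡∂ (n + 1)) j x u) :=
    Gb.hessian_comap_apply contMDiff_pullbackBilin_holds hjs hj' rfl hρ2 u u
  have hGNle : GN.hessian (ρ ∘ j) x u u ≤ A * (r ^ 2 * G.val x u u) := by
    rw [hnat, hr_def, ← hvalap x u u, hGNval]
    exact hA (j x) _
  -- assemble (pure real arithmetic, `convexity_arith`)
  have hGu : 0 < G.val x u u := hGpos x u hu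
  have hα_w : α wα = G.val x wα wα := by rw [hwα, val_sharp_apply]; rfl
  rw [← hwα] at hconfH
  rw [← hα_w] at hnormsq
  exact convexity_arith hA0 hBpos hr hGu hxAB hconfH hGNle hnormsq

end AH

end Literature.Geometry.Riemannian.GGSU
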